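import Literature.Topology.Immersions.HolonomicExtensionSegment
import HarnessLib

/-!
# Extending a formal submersion of `ℝⁿ⁺²` over a compact core (abstract handle step)

Topic `Literature/Topology/Immersions`; the Euclidean core of the handle steps in the
Gromov–Eliashberg–Mishachev route to Phillips' submersion theorem
(`Literature.Topology.Immersions.Phillips1967_exists_isLocalDiffeomorph_of_isParallelizable`),
with the analytic input abstracted. `HolonomicExtensionSegment.lean` proves the step for a
core segment using holonomic approximation over the segment; the argument uses of the core
`C` and its attaching part `B` (there: the two end points) only that a `1`-jet section holonomic
near `B` can be approximated near a `δ`-isotoped copy of `C`, relative to `B`. We record this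
**relative holonomic approximation property** as a `Prop`-valued structure on the output data
(`IsRelHolApprox`) and prove the extension theorem for any compact core enjoying it
(`exists_holonomic_extension_core`), so that holonomic approximation over cubes
(Eliashberg–Mishachev 2001, Thm. 1.3.1) yields the steps for handles of every index `< n`.

* `Literature.Topology.Immersions.IsRelHolApprox C B O F₀ F₁ φ₀ ε δ H E Ω g` — `H` is a `C^∞`
  isotopy of `ℝⁿ⁺²` (`H₀ = id`, `δ`-small, slices with invertible differential, jointly continuous
  with its differential) fixing an open set `E` with `B ⊆ E ⊆ O`; `g` is a `C^∞` map equal to `φ₀`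
  on `E` whose `1`-jet is `ε`-close to `(F₀, F₁)` on the open set `Ω ⊇ H₁(C)`.
* `Literature.Topology.Immersions.exists_cthickening_inter_subset_of_subset` — thin closed tubes
  about a compact `C` meet a closed set `Û` with `Û ∩ C ⊆ E`, `E` open, inside `E`.
* `Literature.Topology.Immersions.exists_holonomic_extension_core` — the extension theorem.
* `Literature.Topology.Immersions.exists_isRelHolApprox_segment` — the property for a segment
  relative to its end points, from the tree's `holonomicApproximation_segment`.
* `Literature.Topology.Immersions.exists_contDiff_approx_eqOn` — relative smoothing of a
  continuous field (the `1`-jet sections fed to explicit cube constructions must be `C^∞`).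

## How the pieces are meant to fit (Morse side ↔ analytic side)

At a critical level `c` of index `k ≥ 1` of a proper Morse function `f` (Morse chart `e` at
`p`, `f ∘ e⁻¹ = c - |y'|² + |y''|²`, the pair being holonomic near `Mᶜ⁻ᵉ''`), the core step
`HolonomicNear.core` (`OpenParallelizableImmersionCore.lean`) is applied with the big set
`U' = Mᶜ⁻ᵉ''`, the small closed set `U = Mᶜ⁻ᵉ' ∪ e⁻¹(P)` (`P` the part of the plane `y'' = 0`
of sup-norm `≥ q_P` inside the chart ball, `ε' = 4k·(q'')²`, `q'' = 2√ε''`, `q_P = 7q''/8`),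
the core `C = [-√ε', √ε']ᵏ × 0 ⊇` the descending disc, and the attaching region
`B = C ∩ {‖y'‖∞ ≥ q_P}` (a cubical collar, `U ∩ C ⊆ B`): a holonomic approximation theorem
over the small cube `[-q'', q'']ᵏ × 0` relative to a fixed collar (wiggle supported in
sup-norm `< q_P`, holonomy used only at sup-norm `≥ q''/2`, where `|y'| ≥ √ε''`) then provides
`IsRelHolApprox C B O' …` for every open `O'` containing the points of `C` read in `U'`, which
is exactly the hypothesis `happrox` of `HolonomicNear.core`; afterwards `Mᶜ⁺ᵉ⁺` is compressed
into any neighbourhood of `U ∪ e⁻¹(C) ⊇ Mᶜ⁻ᵉ' ∪` disc (Milnor 1963, Thm. 3.2, with an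
anisotropic modification `F = f - μ(|y'|² + A|y''|²)` and the push-down flow of `F`), as
required by `Phillips1967_exists_isLocalDiffeomorph_of_isParallelizable_of_compressibleExhaustion`.

## References

* Y. Eliashberg, N. Mishachev, *Holonomic approximation and Gromov's h-principle*,
  arXiv:math/0101196 (2001), §2.1 (proof of Thm. 2.1.2), Thm. 1.3.1. [EliashbergMishachev2001]
* A. Phillips, *Submersions of open manifolds*, Topology **6** (1967), Lemma 4.1, §6.
  [Phillips1967]
-/

open Set Function Filter Metric Real
open scoped Topology ContDiff Manifold

noncomputable section

namespace Literature.Topology.Immersions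

variable {n : ℕ}

/-- Local notation: the model space `ℝⁿ⁺²`. -/
local notation "𝔼₂" => EuclideanSpace ℝ (Fin (n + 2))

/-! ### The relative holonomic approximation property -/

/-- **Relative holonomic approximation data** for a core `C` with attaching part `B` (the shape
of the conclusion of Eliashberg–Mishachev's Thm. 1.3.1, as used by the handle steps): given the
`1`-jet section `(F₀, F₁)`, holonomic (`= J¹φ₀`) on the open set `O ⊇ B`, and `ε, δ > 0`, the
data consist of an isotopy `H : ℝ × ℝⁿ⁺² → ℝⁿ⁺²` — every `H_s` a `C^∞` map with everywhere
invertible differential, `H₀ = id`, `dist (H_s y) y ≤ δ` for `s ∈ [0, 1]`, `(s, y) ↦ H_s y` and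
`(s, y) ↦ D(H_s)_y` continuous — an open set `E` with `B ⊆ E ⊆ O` fixed pointwise by every `H_s`,
an open set `Ω ⊇ H₁(C)`, and a `C^∞` map `g` with `g = φ₀` on `E` and
`‖g - F₀‖ < ε`, `‖Dg - F₁‖ < ε` on `Ω`. [cite: EliashbergMishachev2001, Thm. 1.3.1] -/
structure IsRelHolApprox (C B O : Set (EuclideanSpace ℝ (Fin (n + 2))))
    (F₀ : EuclideanSpace ℝ (Fin (n + 2)) → EuclideanSpace ℝ (Fin (n + 2)))
    (F₁ : EuclideanSpace ℝ (Fin (n + 2)) →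
      EuclideanSpace ℝ (Fin (n + 2)) →L[ℝ] EuclideanSpace ℝ (Fin (n + 2)))
    (φ₀ : EuclideanSpace ℝ (Fin (n + 2)) → EuclideanSpace ℝ (Fin (n + 2))) (ε δ : ℝ)
    (H : ℝ → EuclideanSpace ℝ (Fin (n + 2)) → EuclideanSpace ℝ (Fin (n + 2)))
    (E Ω : Set (EuclideanSpace ℝ (Fin (n + 2))))
    (g : EuclideanSpace ℝ (Fin (n + 2)) → EuclideanSpace ℝ (Fin (n + 2))) : Prop where
  contDiff_H : ∀ s, ContDiff ℝ ∞ (H s)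
  H_zero : ∀ y, H 0 y = y
  dist_le : ∀ s ∈ Icc (0 : ℝ) 1, ∀ y, dist (H s y) y ≤ δ
  isInvertible : ∀ s ∈ Icc (0 : ℝ) 1, ∀ y, (fderiv ℝ (H s) y).IsInvertible
  continuous_H : Continuous fun q : ℝ × EuclideanSpace ℝ (Fin (n + 2)) => H q.1 q.2
  continuous_fderiv : Continuous fun q : ℝ × EuclideanSpace ℝ (Fin (n + 2)) => fderiv ℝ (H q.1) q.2
  isOpen_ends : IsOpen E
  boundary_subset : B ⊆ E
  ends_subset : E ⊆ O
  H_eq_self : ∀ s, ∀ y ∈ E, H s y = y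
  g_eq : ∀ y ∈ E, g y = φ₀ y
  isOpen : IsOpen Ω
  image_subset : ∀ y ∈ C, H 1 y ∈ Ω
  contDiff_g : ContDiff ℝ ∞ g
  approx : ∀ y ∈ Ω, ‖g y - F₀ y‖ < ε ∧ ‖fderiv ℝ g y - F₁ y‖ < ε

/-! ### Thin tubes about a compact core -/

/-- **Thin tubes meet a closed set inside a prescribed open set**: if `Û` is closed, `C`
compact and `Û ∩ C ⊆ E` with `E` open, then some closed tube `cthickening κ C`, `κ > 0`, meets
`Û` inside `E` (`C` and `Û ∖ E` are disjoint, hence at positive distance). [folklore] -/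
theorem exists_cthickening_inter_subset_of_subset {X : Type*} [PseudoMetricSpace X]
    [ProperSpace X] {C U E : Set X} (hC : IsCompact C) (hU : IsClosed U) (hUC : U ∩ C ⊆ E)
    (hE : IsOpen E) : ∃ κ > 0, U ∩ cthickening κ C ⊆ E := by
  have hUE : IsClosed (U \ E) := hU.sdiff hE
  have hdisj : Disjoint C (U \ E) := by
    rw [disjoint_left]
    rintro y hyC ⟨hyU, hyE⟩
    exact hyE (hUC ⟨hyU, hyC⟩)
  obtain ⟨κ, hκ, hthick⟩ := hC.exists_cthickening_subset_open hUE.isOpen_compl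
    (subset_compl_iff_disjoint_right.2 hdisj)
  refine ⟨κ, hκ, fun y ⟨hyU, hyC⟩ => ?_⟩
  by_contra hyE
  exact hthick hyC ⟨hyU, hyE⟩

/-! ### The extension theorem over a compact core -/

/-- **Extending a formal submersion of `ℝⁿ⁺²` over a compact core, relative to its attaching
part** (the handle step of the `h`-principle for submersions, Euclidean form: Eliashberg–Mishachev
2001, §2.1, proof of Thm. 2.1.2 for one cell; Phillips 1967, Lemma 4.1). Let `O ⊆ ℝⁿ⁺²` be
open, `f : ℝⁿ⁺² → ℝⁿ⁺²` a `C^∞` map and `A` a field of invertible continuous linear maps,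
continuous on `O`, with `Df = A` on an open set `W`, `Û ⊆ W ⊆ O`, `Û` closed. Let `C` be a compact
"core" with closed `ρ`-tube in `O` and `B ⊇ Û ∩ C` its "attaching region", and assume the
**relative holonomic approximation property** of the pair `(C, B)`
(`IsRelHolApprox`: every `1`-jet section holonomic on an open set containing `W ∩ C` — so at least
near `B`, but possibly on a larger part of the core, which is what cube versions relative to a
fixed collar need — is `ε`-approximated near an isotoped copy `H₁(C)` of the core, `H_s` a
`δ`-small isotopy fixed near `B`, by a holonomic section equal to the given one near `B` — the
tree's `holonomicApproximation_segment` for segments, holonomic approximation over cubes in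
general). Then there are a `C^∞` map `g`, a field `A'` of invertible
maps continuous on `O`, and an open set `W'` with `Û ∪ C ⊆ W' ⊆ O` such that `Dg = A'` on `W'`, and
`(g, A') = (f, A)` off the open `ρ`-tube of `C`. Construction: `g̃` an `ε₁/2`-approximation near
`H₁(C)` (`ε₁` an invertibility margin of `A` near `C`), `ĝ = g̃ ∘ H₁`, `g = f + χ (ĝ - f)`,
`A' = [(1 - μ) A ∘ H_λ + μ Dg̃ ∘ H_λ] ∘ D(H_λ)` for nested cut-offs `χ ≺ μ ≺ λ` supported in thin
tubes of `C`. [cite: EliashbergMishachev2001, §2.1] -/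
theorem exists_holonomic_extension_core {O : Set 𝔼₂} (hO : IsOpen O) {f : 𝔼₂ → 𝔼₂}
    (hf : ContDiff ℝ ∞ f) {A : 𝔼₂ → 𝔼₂ →L[ℝ] 𝔼₂} (hA : ContinuousOn A O)
    (hinv : ∀ y ∈ O, (A y).IsInvertible) {U W : Set 𝔼₂} (hU : IsClosed U) (hW : IsOpen W)
    (hUW : U ⊆ W) (hWO : W ⊆ O) (hhol : ∀ y ∈ W, fderiv ℝ f y = A y) {C B : Set 𝔼₂}
    (hCc : IsCompact C) {ρ : ℝ} (hρ : 0 < ρ) (hρO : cthickening ρ C ⊆ O) (hUC : U ∩ C ⊆ B)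
    (happrox : ∀ (F₀ : 𝔼₂ → 𝔼₂) (F₁ : 𝔼₂ → 𝔼₂ →L[ℝ] 𝔼₂) (φ₀ : 𝔼₂ → 𝔼₂) (O' : Set 𝔼₂)
      (ε δ : ℝ), Continuous F₀ → Continuous F₁ → ContDiff ℝ ∞ φ₀ → IsOpen O' → W ∩ C ⊆ O' →
      (∀ x ∈ O', φ₀ x = F₀ x ∧ fderiv ℝ φ₀ x = F₁ x) → 0 < ε → 0 < δ →
      ∃ (H : ℝ → 𝔼₂ → 𝔼₂) (E' Ω : Set 𝔼₂) (g : 𝔼₂ → 𝔼₂),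
        IsRelHolApprox C B O' F₀ F₁ φ₀ ε δ H E' Ω g) :
    ∃ (g : 𝔼₂ → 𝔼₂) (A' : 𝔼₂ → 𝔼₂ →L[ℝ] 𝔼₂) (W' : Set 𝔼₂), ContDiff ℝ ∞ g ∧
      ContinuousOn A' O ∧ (∀ y ∈ O, (A' y).IsInvertible) ∧ IsOpen W' ∧
      U ∪ C ⊆ W' ∧ W' ⊆ O ∧ (∀ y ∈ W', fderiv ℝ g y = A' y) ∧
      ∀ y ∉ thickening ρ C, g y = f y ∧ A' y = A y := by
  -- S1: the compact tube `K` and the invertibility margin `ε₁`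
  set K : Set 𝔼₂ := cthickening (ρ / 2) C with hK
  have hKc : IsCompact K := hCc.cthickening
  have hKρ : K ⊆ thickening ρ C := cthickening_subset_thickening' hρ (by linarith) C
  have hKO : K ⊆ O := (cthickening_mono (by linarith) C).trans hρO
  have hCK : thickening (ρ / 2) C ⊆ K := thickening_subset_cthickening _ _
  obtain ⟨ε₁, hε₁, hmargin⟩ := exists_forall_isInvertible_of_norm_sub_lt hKc (hA.mono hKO)
    fun y hy => hinv y (hKO hy)
  -- S2: a globally continuous field `A_ext = χ_A • A`, equal to `A` on `K`
  obtain ⟨χA, hχA, hχA0, hχA1, hχA01⟩ := exists_contDiff_zero_one_of_isClosed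
    (isOpen_thickening (δ := ρ) (E := C)).isClosed_compl isClosed_cthickening
    (disjoint_compl_left_iff_subset.2 hKρ)
  set Aext : 𝔼₂ → 𝔼₂ →L[ℝ] 𝔼₂ := fun y => χA y • A y with hAext
  have hAext_cont : Continuous Aext := by
    have htsupp : tsupport χA ⊆ cthickening ρ C := by
      refine closure_minimal (fun y hy => ?_) isClosed_cthickening
      by_contra hy'
      exact hy (hχA0 (fun h => hy' (thickening_subset_cthickening _ _ h)))
    have h_on : ContinuousOn Aext O := hχA.continuous.continuousOn.smul hA
    have h_off : ContinuousOn Aext (tsupport χA)ᶜ := by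
      refine (continuousOn_const (c := (0 : 𝔼₂ →L[ℝ] 𝔼₂))).congr fun y hy => ?_
      show χA y • A y = 0
      rw [image_eq_zero_of_notMem_tsupport hy]
      exact zero_smul_clm _
    have hunion : O ∪ (tsupport χA)ᶜ = univ := by
      refine eq_univ_of_forall fun y => ?_
      by_cases hy : y ∈ tsupport χA
      · exact Or.inl (hρO (htsupp hy))
      · exact Or.inr hy
    rw [← continuousOn_univ, ← hunion]
    exact h_on.union_of_isOpen h_off hO (isClosed_tsupport χA).isOpen_compl
  have hAext_K : ∀ y ∈ K, Aext y = A y := fun y hy => by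
    simp [hAext, hχA1 hy]
  -- S3: relative holonomic approximation near an isotoped copy of the core
  have hint : ∀ y ∈ C, y ∈ interior K := fun y hy =>
    mem_interior_iff_mem_nhds.2 (mem_of_superset ((isOpen_thickening).mem_nhds
      (self_subset_thickening (by positivity) C hy)) hCK)
  have hOfit : IsOpen (W ∩ interior K) := hW.inter isOpen_interior
  obtain ⟨hs, E, Ω, gt, happ⟩ := happrox f Aext f (W ∩ interior K) (ε₁ / 2) (ρ / 8)
    hf.continuous hAext_cont hf hOfit (fun y hy => ⟨hy.1, hint _ hy.2⟩)
    (fun y hy => ⟨rfl, by rw [hhol y hy.1, hAext_K y (interior_subset hy.2)]⟩)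
    (by positivity) (by positivity)
  have hgt : ContDiff ℝ ∞ gt := happ.contDiff_g
  have hΩ : IsOpen Ω := happ.isOpen
  have hest : ∀ y ∈ Ω, ‖gt y - f y‖ < ε₁ / 2 ∧ ‖fderiv ℝ gt y - Aext y‖ < ε₁ / 2 := happ.approx
  -- S4: the isotopy `H_s` and the end region `E`
  have hhs_dist : ∀ s ∈ Icc (0 : ℝ) 1, ∀ y : 𝔼₂, dist (hs s y) y ≤ ρ / 8 := happ.dist_le
  have hE_open : IsOpen E := happ.isOpen_ends
  have hBE : B ⊆ E := happ.boundary_subset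
  have hEfit : E ⊆ W ∩ interior K := happ.ends_subset
  have hhsE : ∀ s, ∀ y ∈ E, hs s y = y := happ.H_eq_self
  have hgtE : ∀ y ∈ E, gt y = f y := happ.g_eq
  have hDhsE : ∀ s, ∀ y ∈ E, fderiv ℝ (hs s) y = ContinuousLinearMap.id ℝ _ := by
    intro s y hy
    have hev : hs s =ᶠ[𝓝 y] id := Filter.eventuallyEq_of_mem (hE_open.mem_nhds hy) (hhsE s)
    rw [hev.fderiv_eq, fderiv_id]
  have hhs_smooth : ∀ s, ContDiff ℝ ∞ (hs s) := happ.contDiff_H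
  have hhs_cont : Continuous fun q : ℝ × 𝔼₂ => hs q.1 q.2 := happ.continuous_H
  have hDhs_cont : Continuous fun q : ℝ × 𝔼₂ => fderiv ℝ (hs q.1) q.2 := happ.continuous_fderiv
  have hDhs_inv : ∀ s ∈ Icc (0 : ℝ) 1, ∀ y, (fderiv ℝ (hs s) y).IsInvertible := happ.isInvertible
  -- S5: the tube radius `κ`
  have hpre : IsOpen (hs 1 ⁻¹' Ω) :=
    hΩ.preimage (hhs_cont.comp (continuous_const.prodMk continuous_id))
  have hCpre : C ⊆ hs 1 ⁻¹' Ω := fun y hy => happ.image_subset y hy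
  obtain ⟨κb, hκb, hκbΩ⟩ := hCc.exists_cthickening_subset_open hpre hCpre
  obtain ⟨κc, hκc, hκcE⟩ := exists_cthickening_inter_subset_of_subset hCc hU
    (fun y hy => hBE (hUC hy)) hE_open
  set κ : ℝ := min (min κb κc) (ρ / 8) with hκ
  have hκpos : 0 < κ := lt_min (lt_min hκb hκc) (by positivity)
  have hκb' : κ ≤ κb := (min_le_left _ _).trans (min_le_left _ _)
  have hκc' : κ ≤ κc := (min_le_left _ _).trans (min_le_right _ _)
  have hκρ : κ ≤ ρ / 8 := min_le_right _ _
  have hTκΩ : ∀ y ∈ cthickening κ C, hs 1 y ∈ Ω := fun y hy =>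
    hκbΩ (cthickening_mono hκb' C hy)
  have hTκE : U ∩ cthickening κ C ⊆ E := fun y hy => hκcE ⟨hy.1, cthickening_mono hκc' C hy.2⟩
  have hTκK : ∀ s ∈ Icc (0 : ℝ) 1, ∀ y ∈ cthickening κ C, hs s y ∈ K := by
    intro s hs' y hy
    have hmem := mem_thickening_of_mem_cthickening_of_dist_le hκpos.le
      (by linarith : ρ / 8 < ρ / 4) hy (hhs_dist s hs' y)
    refine hCK (thickening_mono ?_ C hmem)
    linarith
  have hTκO : cthickening κ C ⊆ O := fun y hy => by
    have := hTκK 0 ⟨le_rfl, zero_le_one⟩ y hy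
    rw [happ.H_zero y] at this
    exact hKO this
  -- S6: nested cut-offs `χ ≺ μ ≺ λ`
  have hdisj : ∀ {p q : ℝ}, 0 < q → p < q →
      Disjoint (thickening q C)ᶜ (cthickening p C) := fun hq hpq =>
    disjoint_compl_left_iff_subset.2 (cthickening_subset_thickening' hq hpq C)
  obtain ⟨χ, hχs, hχ0, hχ1, hχ01⟩ := exists_contDiff_zero_one_of_isClosed
    (isOpen_thickening (δ := κ / 2) (E := C)).isClosed_compl isClosed_cthickening
    (hdisj (by positivity) (by linarith) (p := κ / 4))
  obtain ⟨μ, hμs, hμ0, hμ1, hμ01⟩ := exists_contDiff_zero_one_of_isClosed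
    (isOpen_thickening (δ := 3 * κ / 4) (E := C)).isClosed_compl isClosed_cthickening
    (hdisj (by positivity) (by linarith) (p := κ / 2))
  obtain ⟨lam, hlams, hlam0, hlam1, hlam01⟩ := exists_contDiff_zero_one_of_isClosed
    (isOpen_thickening (δ := κ) (E := C)).isClosed_compl isClosed_cthickening
    (hdisj hκpos (by linarith) (p := 3 * κ / 4))
  -- support consequences
  have hχ_supp : ∀ y, χ y ≠ 0 → y ∈ thickening (κ / 2) C := fun y hy => by
    by_contra h'; exact hy (hχ0 h')
  have hμ_supp : ∀ y, μ y ≠ 0 → y ∈ thickening (3 * κ / 4) C := fun y hy => by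
    by_contra h'; exact hy (hμ0 h')
  have hlam_supp : ∀ y, lam y ≠ 0 → y ∈ thickening κ C := fun y hy => by
    by_contra h'; exact hy (hlam0 h')
  have hμ_of_χ : ∀ y, χ y ≠ 0 → μ y = 1 := fun y hy =>
    hμ1 (thickening_subset_cthickening _ _ (hχ_supp y hy))
  have hlam_of_μ : ∀ y, μ y ≠ 0 → lam y = 1 := fun y hy =>
    hlam1 (thickening_subset_cthickening _ _ (hμ_supp y hy))
  have hlam_of_χ : ∀ y, χ y ≠ 0 → lam y = 1 := fun y hy => hlam_of_μ y (by
    rw [hμ_of_χ y hy]; exact one_ne_zero)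
  -- S7: the new pair
  set gh : 𝔼₂ → 𝔼₂ := fun y => gt (hs 1 y) with hgh
  set g : 𝔼₂ → 𝔼₂ := fun y => f y + χ y • (gh y - f y) with hg
  set H : 𝔼₂ → 𝔼₂ := fun y => hs (lam y) y with hH
  set Bf : 𝔼₂ → 𝔼₂ →L[ℝ] 𝔼₂ := fun y =>
    (1 - μ y) • A (H y) + μ y • fderiv ℝ gt (H y) with hB
  set A' : 𝔼₂ → 𝔼₂ →L[ℝ] 𝔼₂ := fun y => (Bf y).comp (fderiv ℝ (hs (lam y)) y) with hA'
  set W' : Set 𝔼₂ := interior (cthickening (κ / 4) C) ∪ ((W ∩ E) ∪ (W ∩ (cthickening κ C)ᶜ))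
    with hW'
  -- basic identities
  have hH_of_lam0 : ∀ y, lam y = 0 → H y = y := fun y hy => by
    show hs (lam y) y = y
    rw [hy, happ.H_zero y]
  have hH_of_lam1 : ∀ y, lam y = 1 → H y = hs 1 y := fun y hy => by
    show hs (lam y) y = _
    rw [hy]
  have hH_mem_O : ∀ y ∈ O, H y ∈ O := fun y hy => by
    by_cases hl : lam y = 0
    · rwa [hH_of_lam0 y hl]
    · exact hKO (hTκK (lam y) (hlam01 y) y (thickening_subset_cthickening _ _ (hlam_supp y hl)))
  have hH_cont : Continuous H := hhs_cont.comp (hlams.continuous.prodMk continuous_id)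
  have hgh_smooth : ContDiff ℝ ∞ gh := hgt.comp (hhs_smooth 1)
  have hg_smooth : ContDiff ℝ ∞ g := hf.add (hχs.smul (hgh_smooth.sub hf))
  -- where things are trivial
  have hg_of_χ0 : ∀ y, χ y = 0 → g y = f y := fun y hy => by simp [hg, hy]
  have hB_of_zero : ∀ y, μ y = 0 → Bf y = A (H y) := fun y hm => by
    ext v
    simp [hB, hm]
  have hDhs_zero : ∀ y, fderiv ℝ (hs 0) y = ContinuousLinearMap.id ℝ _ := fun y => by
    have : hs 0 = id := funext happ.H_zero
    rw [this, fderiv_id]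
  have hA'_of_zero : ∀ y, lam y = 0 → μ y = 0 → A' y = A y := fun y hl hm => by
    show (Bf y).comp (fderiv ℝ (hs (lam y)) y) = A y
    rw [hB_of_zero y hm, hH_of_lam0 y hl, hl, hDhs_zero y, ContinuousLinearMap.comp_id]
  refine ⟨g, A', W', hg_smooth, ?_, ?_, ?_, ?_, ?_, ?_, ?_⟩
  · -- continuity of `A'` on `O`
    have hAH : ContinuousOn (fun y => A (H y)) O := hA.comp hH_cont.continuousOn hH_mem_O
    have hB_cont : ContinuousOn Bf O :=
      ((continuous_const.sub hμs.continuous).continuousOn.smul hAH).add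
        (hμs.continuous.continuousOn.smul
          ((hgt.continuous_fderiv (by simp)).comp_continuousOn hH_cont.continuousOn))
    have hS_cont : Continuous fun y => fderiv ℝ (hs (lam y)) y :=
      hDhs_cont.comp (hlams.continuous.prodMk continuous_id)
    exact hB_cont.clm_comp hS_cont.continuousOn
  · -- invertibility of `A' y`, `y ∈ O`
    intro y hy
    have hS := hDhs_inv (lam y) (hlam01 y) y
    suffices hBinv : (Bf y).IsInvertible from hBinv.comp hS
    by_cases hm : μ y = 0
    · rw [hB_of_zero y hm]
      exact hinv _ (hH_mem_O y hy)
    · have hl : lam y = 1 := hlam_of_μ y hm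
      have hHy : H y = hs 1 y := hH_of_lam1 y hl
      have hyT : y ∈ cthickening κ C :=
        cthickening_mono (by linarith) C (thickening_subset_cthickening _ _ (hμ_supp y hm))
      have hHK : H y ∈ K := by
        rw [hHy]
        exact hTκK 1 ⟨zero_le_one, le_rfl⟩ y hyT
      have hHΩ : H y ∈ Ω := hHy ▸ hTκΩ y hyT
      have hclose : ‖fderiv ℝ gt (H y) - A (H y)‖ < ε₁ / 2 := by
        have := (hest _ hHΩ).2
        rwa [hAext_K _ hHK] at this
      refine hmargin (H y) hHK (Bf y) ?_
      have hsplit : Bf y - A (H y) = μ y • (fderiv ℝ gt (H y) - A (H y)) := by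
        refine ContinuousLinearMap.ext fun v => ?_
        show ((1 - μ y) • A (H y) v + μ y • fderiv ℝ gt (H y) v) - A (H y) v =
          μ y • (fderiv ℝ gt (H y) v - A (H y) v)
        module
      rw [hsplit, norm_smul, Real.norm_of_nonneg (hμ01 y).1]
      calc μ y * ‖fderiv ℝ gt (H y) - A (H y)‖ ≤ 1 * (ε₁ / 2) :=
            mul_le_mul (hμ01 y).2 hclose.le (norm_nonneg _) zero_le_one
        _ < ε₁ := by linarith
  · -- `W'` is open
    exact isOpen_interior.union ((hW.inter hE_open).union (hW.inter isClosed_cthickening.isOpen_compl))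
  · -- `U ∪ C ⊆ W'`
    rintro y (hyU | hyC)
    · by_cases hyT : y ∈ cthickening κ C
      · exact Or.inr (Or.inl ⟨hUW hyU, hTκE ⟨hyU, hyT⟩⟩)
      · exact Or.inr (Or.inr ⟨hUW hyU, hyT⟩)
    · refine Or.inl (mem_interior_iff_mem_nhds.2 (mem_of_superset
        ((isOpen_thickening).mem_nhds (self_subset_thickening (by positivity) C hyC))
        (thickening_subset_cthickening (κ / 4) C)))
  · -- `W' ⊆ O`
    rintro y (hy | ⟨hy, -⟩ | ⟨hy, -⟩)
    · exact hTκO (cthickening_mono (by linarith) C (interior_subset hy))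
    · exact hWO hy
    · exact hWO hy
  · -- holonomy on `W'`
    rintro y (hy | ⟨hyW, hyE⟩ | ⟨hyW, hyT⟩)
    · -- near the core: `g = ĝ` near `y`, `A' = D ĝ`
      have hχ_near : ∀ᶠ z in 𝓝 y, χ z = 1 := by
        filter_upwards [isOpen_interior.mem_nhds hy] with z hz
        exact hχ1 (interior_subset hz)
      have hgev : g =ᶠ[𝓝 y] gh := by
        filter_upwards [hχ_near] with z hz
        simp [hg, hz]
      rw [hgev.fderiv_eq]
      have hyκ4 : y ∈ cthickening (κ / 4) C := interior_subset hy
      have hχy : χ y = 1 := hχ1 hyκ4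
      have hly : lam y = 1 := hlam_of_χ y (by rw [hχy]; exact one_ne_zero)
      have hmy : μ y = 1 := hμ_of_χ y (by rw [hχy]; exact one_ne_zero)
      -- chain rule for `ĝ = gt ∘ H₁`
      have hchain : HasFDerivAt gh ((fderiv ℝ gt (hs 1 y)).comp (fderiv ℝ (hs 1) y)) y :=
        ((hgt.differentiable (by simp)) _).hasFDerivAt.comp y
          (((hhs_smooth 1).differentiable (by simp)) y).hasFDerivAt
      rw [hchain.fderiv]
      have hBy : Bf y = fderiv ℝ gt (hs 1 y) := by
        ext v
        simp [hB, hmy, hH_of_lam1 y hly]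
      show _ = (Bf y).comp (fderiv ℝ (hs (lam y)) y)
      rw [hly, hBy]
    · -- in the end regions: everything is the identity, `g = f`, `A' = A`
      have hgev : g =ᶠ[𝓝 y] f := by
        filter_upwards [hE_open.mem_nhds hyE] with z hz
        have : gh z = f z := by
          show gt (hs 1 z) = f z
          rw [hhsE 1 z hz, hgtE z hz]
        simp [hg, this]
      rw [hgev.fderiv_eq, hhol y hyW]
      have hHy : H y = y := hhsE (lam y) y hyE
      have hgtev : gt =ᶠ[𝓝 y] f := Filter.eventuallyEq_of_mem (hE_open.mem_nhds hyE) hgtE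
      have hDgt : fderiv ℝ gt y = A y := by rw [hgtev.fderiv_eq, hhol y hyW]
      have hS : fderiv ℝ (hs (lam y)) y = ContinuousLinearMap.id ℝ _ := hDhsE (lam y) y hyE
      have hBy : Bf y = A y := by
        refine ContinuousLinearMap.ext fun v => ?_
        show (1 - μ y) • A (H y) v + μ y • fderiv ℝ gt (H y) v = A y v
        rw [hHy, hDgt]
        module
      show A y = (Bf y).comp (fderiv ℝ (hs (lam y)) y)
      rw [hS, ContinuousLinearMap.comp_id, hBy]
    · -- off the tube: `g = f`, `A' = A`
      have hopen : IsOpen (cthickening κ C)ᶜ := isClosed_cthickening.isOpen_compl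
      have hzero : ∀ z ∈ (cthickening κ C)ᶜ, χ z = 0 ∧ μ z = 0 ∧ lam z = 0 := by
        intro z hz
        refine ⟨?_, ?_, ?_⟩
        · by_contra h'; exact hz (cthickening_mono (by linarith) C
            (thickening_subset_cthickening _ _ (hχ_supp z h')))
        · by_contra h'; exact hz (cthickening_mono (by linarith) C
            (thickening_subset_cthickening _ _ (hμ_supp z h')))
        · by_contra h'; exact hz (thickening_subset_cthickening _ _ (hlam_supp z h'))
      have hgev : g =ᶠ[𝓝 y] f := by
        filter_upwards [hopen.mem_nhds hyT] with z hz
        exact hg_of_χ0 z (hzero z hz).1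
      rw [hgev.fderiv_eq, hhol y hyW, hA'_of_zero y (hzero y hyT).2.2 (hzero y hyT).2.1]
  · -- off the `ρ`-tube nothing changed
    intro y hy
    have hyT : y ∉ cthickening κ C := fun h' => hy (hKρ (by
      exact (cthickening_mono (by linarith) C) h'))
    have hχy : χ y = 0 := by
      by_contra h'; exact hyT (cthickening_mono (by linarith) C
        (thickening_subset_cthickening _ _ (hχ_supp y h')))
    have hμy : μ y = 0 := by
      by_contra h'; exact hyT (cthickening_mono (by linarith) C
        (thickening_subset_cthickening _ _ (hμ_supp y h')))
    have hly : lam y = 0 := by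
      by_contra h'; exact hyT (thickening_subset_cthickening _ _ (hlam_supp y h'))
    exact ⟨hg_of_χ0 y hχy, hA'_of_zero y hly hμy⟩

/-! ### The segment has the relative holonomic approximation property -/

/-- **Segments have the relative holonomic approximation property** (with attaching part the
two end points): the tree's `holonomicApproximation_segment` (Eliashberg–Mishachev 2001,
Thm. 1.3.1 for `k = 1`) provides the data of `IsRelHolApprox`, the isotopy being the partial
shears `H_s = shear (s φ_N) 0 1` by the wiggle and the fixed end region
`E = O ∩ ({y₀ < a} ∪ {y₀ > 1 - a'})`. [cite: EliashbergMishachev2001, Thm. 1.3.1] -/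
theorem exists_isRelHolApprox_segment (F₀ : 𝔼₂ → 𝔼₂) (F₁ : 𝔼₂ → 𝔼₂ →L[ℝ] 𝔼₂) (φ₀ : 𝔼₂ → 𝔼₂)
    (O : Set 𝔼₂) (ε δ : ℝ) (h₀ : Continuous F₀) (h₁ : Continuous F₁) (hφ₀ : ContDiff ℝ ∞ φ₀)
    (hO : IsOpen O) (hB : ({coreLine n 0, coreLine n 1} : Set 𝔼₂) ⊆ O)
    (hhol : ∀ x ∈ O, φ₀ x = F₀ x ∧ fderiv ℝ φ₀ x = F₁ x) (hε : 0 < ε) (hδ : 0 < δ) :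
    ∃ (H : ℝ → 𝔼₂ → 𝔼₂) (E Ω : Set 𝔼₂) (g : 𝔼₂ → 𝔼₂),
      IsRelHolApprox (coreLine n '' Icc 0 1) {coreLine n 0, coreLine n 1} O F₀ F₁ φ₀ ε δ H E Ω g := by
  have h0O : coreLine n 0 ∈ O := hB (Or.inl rfl)
  have h1O : coreLine n 1 ∈ O := hB (Or.inr rfl)
  obtain ⟨N, δ₁, hN, hδ₁, hδ₁δ, g, Ω, hg, hΩ, hcore, hest, ⟨r, hr, hleft⟩, ⟨r', hr', hright⟩⟩ :=
    holonomicApproximation_segment (F := 𝔼₂) h₀ h₁ hφ₀ hO h0O h1O hhol hε hδ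
  have hN' : (0 : ℝ) < N := by exact_mod_cast hN
  set φ : ℝ → ℝ := wiggle N δ₁ with hφ
  have hφs : ContDiff ℝ ∞ φ := contDiff_wiggle N δ₁
  set H : ℝ → 𝔼₂ → 𝔼₂ := fun s => shear (fun t => s * φ t) 0 1 with hH
  have h01 : (0 : Fin (n + 2)) ≠ 1 := by simp
  set a : ℝ := min r (1 / (8 * N)) with ha
  set a' : ℝ := min r' (1 / (8 * N)) with ha'
  have hapos : 0 < a := lt_min hr (by positivity)
  have ha'pos : 0 < a' := lt_min hr' (by positivity)
  have hale : a ≤ 1 / (8 * N) := min_le_right _ _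
  have ha'le : a' ≤ 1 / (8 * N) := min_le_right _ _
  have har : a ≤ r := min_le_left _ _
  have ha'r : a' ≤ r' := min_le_left _ _
  have hc0 : Continuous fun y : 𝔼₂ => y 0 := (EuclideanSpace.proj (0 : Fin (n + 2)) : 𝔼₂ →L[ℝ] ℝ).continuous
  set E : Set 𝔼₂ := O ∩ ({y | y 0 < a} ∪ {y | 1 - a' < y 0}) with hE
  have hE_open : IsOpen E :=
    hO.inter ((isOpen_lt hc0 continuous_const).union (isOpen_lt continuous_const hc0))
  have hφE : ∀ y ∈ E, φ (y 0) = 0 := by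
    rintro y ⟨-, hy | hy⟩ <;> simp only [mem_setOf_eq] at hy
    · exact wiggle_of_le hN δ₁ (by linarith)
    · exact wiggle_of_ge hN δ₁ (by linarith)
  have hgE : ∀ y ∈ E, g y = φ₀ y := by
    rintro y ⟨-, hy | hy⟩ <;> simp only [mem_setOf_eq] at hy
    · exact hleft y (by linarith)
    · exact hright y (by linarith)
  have hHE : ∀ s, ∀ y ∈ E, H s y = y := fun s y hy => shear_eq_self (by
    show s * φ (y 0) = 0
    rw [hφE y hy, mul_zero])
  have hD : ∀ s y, fderiv ℝ (H s) y = shearFDeriv φ s y := fun s y =>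
    (hasFDerivAt_shear_smul hφs s y).fderiv
  have hH1 : H 1 = shear φ 0 1 := by
    funext y
    simp [hH, shear_apply]
  refine ⟨H, E, Ω, g, ⟨fun s => contDiff_shear (contDiff_const.mul hφs) 0 1, fun y => ?_, ?_, fun s hs y => ?_,
    ?_, ?_, hE_open, ?_, inter_subset_left, hHE, hgE, hΩ, fun y hy => ?_, hg, hest⟩⟩
  · exact shear_eq_self (by show 0 * φ (y 0) = 0; ring)
  · intro s hs y
    rw [dist_eq_norm, hH, norm_shear_sub, abs_mul, abs_of_nonneg hs.1]
    calc s * |φ (y 0)| ≤ 1 * δ₁ :=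
          mul_le_mul hs.2 (abs_wiggle_le N hδ₁.le _) (abs_nonneg _) zero_le_one
      _ ≤ δ := by linarith
  · rw [hD]
    exact isInvertible_shearFDeriv φ s y
  · show Continuous fun q : ℝ × 𝔼₂ => shear (fun t => q.1 * φ t) 0 1 q.2
    simp only [shear_apply]
    exact continuous_snd.add ((continuous_fst.mul (hφs.continuous.comp
      (hc0.comp continuous_snd))).smul continuous_const)
  · have : (fun q : ℝ × 𝔼₂ => fderiv ℝ (H q.1) q.2) = fun q => shearFDeriv φ q.1 q.2 := by
      funext q
      exact hD q.1 q.2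
    rw [this]
    exact continuous_shearFDeriv hφs
  · rintro y (rfl | rfl)
    · exact ⟨h0O, Or.inl (by simp only [mem_setOf_eq, coreLine_apply_zero]; exact hapos)⟩
    · exact ⟨h1O, Or.inr (by simp only [mem_setOf_eq, coreLine_apply_zero]; linarith)⟩
  · obtain ⟨s, hs, rfl⟩ := hy
    rw [hH1]
    exact hcore s hs

/-! ### Relative smoothing of continuous fields -/

section Smoothing

variable {E : Type*} [NormedAddCommGroup E] [NormedSpace ℝ E] [FiniteDimensional ℝ E]
  {F : Type*} [NormedAddCommGroup F] [NormedSpace ℝ F]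

/-- **Smoothing a continuous field relative to a closed set**: a continuous map `F₁ : E → F` on a
finite-dimensional space which agrees with a `C^∞` map `G` on an open set `O` can be uniformly
`ε`-approximated by a `C^∞` map equal to `G` on any closed `S ⊆ O` (smooth partition of unity,
`exists_contMDiffMap_forall_mem_convex_of_local`). [folklore] -/
theorem exists_contDiff_approx_eqOn {F₁ G : E → F} (hF₁ : Continuous F₁) (hG : ContDiff ℝ ∞ G)
    {O S : Set E} (hO : IsOpen O) (hS : IsClosed S) (hSO : S ⊆ O) (hGO : ∀ x ∈ O, G x = F₁ x)
    {ε : ℝ} (hε : 0 < ε) :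
    ∃ A : E → F, ContDiff ℝ ∞ A ∧ (∀ x, ‖A x - F₁ x‖ < ε) ∧ ∀ x ∈ S, A x = G x := by
  let t : E → Set F := fun x => {v | ‖v - F₁ x‖ < ε ∧ (x ∈ S → v = G x)}
  have ht : ∀ x, Convex ℝ (t x) := by
    intro x
    by_cases hx : x ∈ S
    · have : t x = {G x} := by
        ext v
        simp only [t, mem_setOf_eq, hx, forall_true_left, mem_singleton_iff]
        constructor
        · exact fun h => h.2
        · intro h
          subst h
          exact ⟨by simpa [hGO x (hSO hx)] using hε, rfl⟩
      rw [this]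
      exact convex_singleton _
    · have : t x = ball (F₁ x) ε := by
        ext v
        simp [t, hx, dist_eq_norm]
      rw [this]
      exact convex_ball _ _
  have Hloc : ∀ x : E, ∃ U ∈ 𝓝 x, ∃ g : E → F,
      ContMDiffOn 𝓘(ℝ, E) 𝓘(ℝ, F) ∞ g U ∧ ∀ y ∈ U, g y ∈ t y := by
    intro x
    by_cases hx : x ∈ O
    · refine ⟨O, hO.mem_nhds hx, G, hG.contMDiff.contMDiffOn, fun y hy => ?_⟩
      exact ⟨by simpa [hGO y hy] using hε, fun _ => rfl⟩
    · have hxS : x ∉ S := fun h => hx (hSO h)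
      have h1 : ∀ᶠ y in 𝓝 x, ‖F₁ x - F₁ y‖ < ε := by
        have := (hF₁.tendsto x).eventually (Metric.ball_mem_nhds (F₁ x) hε)
        filter_upwards [this] with y hy
        have hy' : dist (F₁ y) (F₁ x) < ε := hy
        rwa [dist_eq_norm, norm_sub_rev] at hy'
      have h2 : ∀ᶠ y in 𝓝 x, y ∉ S := hS.isOpen_compl.mem_nhds hxS
      refine ⟨{y | ‖F₁ x - F₁ y‖ < ε ∧ y ∉ S}, h1.and h2, fun _ => F₁ x, contMDiffOn_const,
        fun y hy => ⟨hy.1, fun h => absurd h hy.2⟩⟩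
  obtain ⟨g, hg⟩ := exists_contMDiffMap_forall_mem_convex_of_local 𝓘(ℝ, E) ht Hloc
  refine ⟨g, ?_, fun x => (hg x).1, fun x hx => (hg x).2 hx⟩
  exact contMDiff_iff_contDiff.1 g.contMDiff

end Smoothing

end Literature.Topology.Immersions
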